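import Literature.NumberTheory.Automorphic.LanglandsTunnellDihedral
import Literature.NumberTheory.Automorphic.ArtinLFunctionsAbelianHeckeProofs
import Literature.NumberTheory.Automorphic.LanglandsTetrahedral
import Literature.NumberTheory.GaloisRepresentations.ArtinFormalismInductionProofs
import HarnessLib

/-!
# Langlands–Tunnell, Artin side: the target from the current leaves of its decomposition
(pure proofs; companion to `Literature.NumberTheory.Automorphic.ArtinLFunctions`,
`LanglandsTunnellDihedral`, `ArtinLFunctionsAbelianHeckeProofs`, `TunnellOctahedralGlobal`,
`TunnellLemma`, `LanglandsTetrahedral`)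

The named fact `Literature.NumberTheory.Automorphic.langlands_tunnell_hasEntireContinuation`
(`Automorphic/ArtinLFunctions`: an odd irreducible continuous `ρ : Γ_ℚ → GL_2(ℂ)` with solvable
image has entire Artin L-function) is the `F = ℚ` case of what Tunnell, *Artin's conjecture
for representations of octahedral type*, Bull. AMS (N.S.) 5 (1981), prints on p. 173: Artin's
conjecture holds for two-dimensional `ρ` with solvable image over any number field `F`, by
"Artin [1] proved this for monomial representations" (dihedral type), "In [5] Langlands proved
Artin's conjecture for all two-dimensional representations of tetrahedral type", and the
Theorem of the note (p. 175: "Let `ρ` be an octahedral representation of `Gal(\bar Q/F)`.  Then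
`π(ρ)` exists, and hence `L(ρ, s)` is entire"), the "hence" being p. 173, ¶2: "When `π = π(ρ)`
the L-series of `π` and `ρ` agree, and since cuspidal representations have entire L-series,
Artin's conjecture follows."  (Oddness is not needed for entireness; it is kept in the fact
because its `F = ℚ` twin lang.S30 produces a *holomorphic* weight-one newform.)

The tree decomposes the fact along exactly these lines, in several files and by several
hands.  This file only **assembles**: it records, as single proved implications, the target
from the *current leaves* of that decomposition, so that the trust base of the fact can be read
off one statement.  No definition, no new named fact, nothing restated.

* `langlands_tunnell_hasEntireContinuation_of_leaves` (**proved**).  Leaves: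
  1. Artin reciprocity for characters of degree one, ideal-theoretically
     (`GaloisRepresentations.artinReciprocity_rankOne K` over every number field `K : Type`;
     Neukirch VI (7.1) with (6.6), VII (10.6) proof: a modulus `𝔣 ≠ 0` supported on the ramified
     primes of `ψ : Γ_K → GL_1(ℂ)` and a ray class character `χ̃ mod 𝔣` with `χ̃(𝔭) = ψ(φ_𝔭)`
     for `𝔭 ∤ 𝔣`; global class field theory, absent from Mathlib) — from which the abelian case
     of Artin's conjecture `artinLFunction_hasEntireContinuation_of_rank_one` is the **proved**
     `artinLFunction_hasEntireContinuation_of_rank_one_of_artinReciprocity_rankOne`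
     (`ArtinLFunctionsAbelianHeckeProofs`: Neukirch VII (10.6) and the last paragraph of §10, with
     Hecke's continuation of the ray class L-series `L(χ̃, s)`, `χ̃ ≠ 1`, now a theorem of the
     tree, `LFunctions.exists_rayClassPartialZeta_eq_add_div` with
     `LFunctions.exists_differentiable_eq_rayClassLSeries_of_partialZeta`), and which with the
     **proved** induction invariance of Artin L-functions
     (`artinLFunction_eq_of_isInducedFrom_holds`, Neukirch VII (10.4) (iv)) is the monomial
     (dihedral) case "Artin [1]";
  2. `strongArtin_of_isTetrahedralType` (Langlands 1980, §3: `π(σ)` exists, tetrahedral `σ`);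
  3. `strongArtin_of_isOctahedralType` (Tunnell 1981, Theorem: `π(σ)` exists, octahedral `σ`);
  4. the bridge `hasEntireContinuation_artinLFunction_of_isPiOfArtinRep` (Tunnell p. 173, ¶2;
     Jacquet–Langlands 1970, §§11–12).
  The case split (finite image; irreducible solvable ⇒ dihedral, tetrahedral or octahedral) is
  the proved `projectiveType_of_isIrreducible_of_isSolvable'`; the general-`F` form is
  `hasEntireContinuation_artinLFunction_of_isSolvable_of_leaves`.  (An earlier revision of this
  file took, in place of leaf 1, the idelic pair "abelian Artin L-functions are primitive Hecke
  L-functions with the Frobenius values" + "Hecke's continuation for unitary Hecke characters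
  that are not norm twists" (Tate 1950, Thm. 4.4.1); the first of these is the reciprocity law
  together with the conductor–ramification theorem VI (6.6), more than the dihedral leg uses,
  and the second is no longer needed as a hypothesis.)
* `langlands_tunnell_hasEntireContinuation_of_functoriality` (**proved**).  The same with
  leaves 2 and 3 replaced by the functorial inputs from which `LanglandsTetrahedral`
  (`strongArtin_of_isTetrahedralType_of_adjoint_lift`, Gelbart 1997 §7.1) and
  `TunnellOctahedralGlobal` / `TunnellLemma` (`strongArtin_of_isOctahedralType_of_tunnell_lemma`,
  `tunnell_lemma_of_fibres`, Tunnell pp. 174–175) prove them: the dihedral case of strong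
  Artin (Jacquet–Langlands §12, needed for the restrictions `σ_E`, `σ_K` to the fields cut out
  by `D₂ ◁ A₄`, `A₄ ◁ S₄` and a `2`-Sylow `D₄ ≤ S₄`), cubic descent with determinant, the
  Gelbart–Jacquet adjoint lift, `π(Ad σ)`, Jacquet–Shalika, cyclic descent of prime degree,
  the quadratic twist, the fibres of quadratic base change (Arthur–Clozel III.3.1), Tunnell's
  cuspidal cubic lifts (Jacquet–Piatetski-Shapiro–Shalika, C. R. Acad. Sci. 292 (1981)),
  Chebotarev for Artin representations, Flath's two Satake facts, and the bridge.  Since the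
  dihedral case of strong Artin is an input of the deeper layers anyway, the classical dihedral
  leg (leaf 1) is subsumed here by `strongArtin_of_isDihedralType` and the bridge
  (`langlands_tunnell_hasEntireContinuation_of_cases`).

Design: `open scoped Classical` is needed to *state* the two Satake hypotheses about
`AutomorphicRepData (AutomorphyDatum.gl n K _)` (decidability of real/complex places inside
`mixedSpace K`), exactly as in `LanglandsTetrahedral` and `TunnellOctahedralGlobal`.

## References

* J. Tunnell, *Artin's conjecture for representations of octahedral type*, Bull. AMS (N.S.) 5
  (1981), 173–175: p. 173 ¶1–2, Lemma (p. 174), Theorem (p. 175). [Tunnell1981]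
* R. P. Langlands, *Base Change for GL(2)*, Ann. of Math. Studies 96 (1980), §3.
  [LanglandsBaseChange1980]
* H. Jacquet, R. P. Langlands, *Automorphic Forms on GL(2)*, LNM 114 (1970), §§11–12.
  [JacquetLanglands1970]
* J. Neukirch, *Algebraic Number Theory* (1999), VI (6.6), (7.1); VII (8.5)–(8.6), (10.4) (iv),
  (10.6) and §10, last paragraph. [NeukirchANT1999]
* S. Gelbart, *Three lectures on the modularity of `ρ̄_{E,3}` and the Langlands reciprocity
  conjecture* (1997), Thm. 1.3 and Remark (1), §7.1, §7.2. [Gelbart1997]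
-/

noncomputable section

open scoped Classical
open Field

namespace Literature.NumberTheory.Automorphic

/-! ### The target from the four current leaves -/

section Leaves

variable {F : Type} [Field F] [NumberField F]

/-- **Artin's conjecture for irreducible `σ : Γ_F → GL_2(ℂ)` with solvable image, from the
current leaves** (Tunnell 1981, p. 173: Artin (monomial) + Langlands (tetrahedral) + Tunnell
(octahedral), the "hence" of p. 173 ¶2).  Granting (1) Artin reciprocity for degree-one
characters in the ideal-theoretic form `GaloisRepresentations.artinReciprocity_rankOne K` over
every number field `K : Type` (Neukirch VI (7.1) with (6.6)), (2) the tetrahedral and (3) the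
octahedral cases of the strong Artin conjecture and (4) the bridge "`π = π(σ)` cuspidal ⇒
`L(s, σ)` entire", every continuous irreducible `σ : Γ_F → GL_2(ℂ)` with solvable image has
entire Artin L-function.  The dihedral leg is classical and, given (1), proved in the tree:
induction invariance is the theorem `artinLFunction_eq_of_isInducedFrom_holds`, the abelian case
is `artinLFunction_hasEntireContinuation_of_rank_one_of_artinReciprocity_rankOne` applied to (1)
(Neukirch VII (10.6) and §10, last paragraph; Hecke's continuation of ray class L-series being a
theorem of the tree). [cite: Tunnell1981, p. 173 and Theorem] [cite: LanglandsBaseChange1980, §3]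
[cite: NeukirchANT1999, VII (10.4) (iv), (10.6) and §10, last paragraph; VI (7.1)] -/
theorem hasEntireContinuation_artinLFunction_of_isSolvable_of_leaves
    (hR : ∀ (K : Type) [Field K] [NumberField K], GaloisRepresentations.artinReciprocity_rankOne K)
    (ht : strongArtin_of_isTetrahedralType) (ho : strongArtin_of_isOctahedralType)
    (hB : hasEntireContinuation_artinLFunction_of_isPiOfArtinRep)
    (σ : GaloisRepresentations.FramedArtinRep F 2) (hirr : σ.toGaloisRep.IsIrreducible)
    (hsolv : IsSolvable σ.toMonoidHom.range) :
    GaloisRepresentations.LFunction.HasEntireContinuation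
      (GaloisRepresentations.artinLFunction σ.toArtinRep) :=
  hasEntireContinuation_artinLFunction_of_isSolvable_of_rank_one_of_cases
    (fun _ _ _ _ => GaloisRepresentations.artinLFunction_eq_of_isInducedFrom_holds)
    (artinLFunction_hasEntireContinuation_of_rank_one_of_artinReciprocity_rankOne hR) ht ho hB σ
    hirr hsolv

end Leaves

/-- **The target from the four current leaves (`F = ℚ`).**  The named fact
`langlands_tunnell_hasEntireContinuation` of `Automorphic/ArtinLFunctions` follows from:
(1) `GaloisRepresentations.artinReciprocity_rankOne K` over every number field `K : Type` (Artin
reciprocity for characters of degree one, Neukirch VI (7.1) with (6.6); global class field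
theory), (2) `strongArtin_of_isTetrahedralType` (Langlands 1980, §3),
(3) `strongArtin_of_isOctahedralType` (Tunnell 1981, Theorem), (4)
`hasEntireContinuation_artinLFunction_of_isPiOfArtinRep` (Tunnell 1981, p. 173 ¶2); induction
invariance, the abelian case of Artin's conjecture given (1) (Neukirch VII (10.6) with Hecke's
continuation of ray class L-series, `ArtinLFunctionsAbelianHeckeProofs`), finite image and the
solvable Klein trichotomy being theorems of the tree.  The oddness hypothesis of the target is
unused. [cite: Tunnell1981, p. 173 and Theorem] [cite: LanglandsBaseChange1980, §3]
[cite: NeukirchANT1999, VII (10.4) (iv), (10.6) and §10, last paragraph; VI (7.1)] -/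
theorem langlands_tunnell_hasEntireContinuation_of_leaves
    (hR : ∀ (K : Type) [Field K] [NumberField K], GaloisRepresentations.artinReciprocity_rankOne K)
    (ht : strongArtin_of_isTetrahedralType) (ho : strongArtin_of_isOctahedralType)
    (hB : hasEntireContinuation_artinLFunction_of_isPiOfArtinRep) :
    langlands_tunnell_hasEntireContinuation :=
  langlands_tunnell_hasEntireContinuation_of_rank_one_of_cases
    (fun _ _ _ _ => GaloisRepresentations.artinLFunction_eq_of_isInducedFrom_holds)
    (artinLFunction_hasEntireContinuation_of_rank_one_of_artinReciprocity_rankOne hR) ht ho hB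

/-! ### The target from the functorial leaves of the tetrahedral and octahedral cases -/

/-- **The target from the functorial inputs (`F = ℚ`).**  Replacing the tetrahedral and
octahedral cases of the strong Artin conjecture by the inputs from which the tree proves them
(`strongArtin_of_isTetrahedralType_of_adjoint_lift`, Gelbart 1997 §7.1 after Langlands 1980
§3; `strongArtin_of_isOctahedralType_of_tunnell_lemma` with `tunnell_lemma_of_fibres`, Tunnell
1981 pp. 174–175): the dihedral case of strong Artin (Jacquet–Langlands §12; used for `σ_E`,
`σ_K`), cubic descent with determinant, the Gelbart–Jacquet adjoint lift, `π(Ad σ)`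
(Jacquet–Piatetski-Shapiro–Shalika 1979), Jacquet–Shalika 1981, cyclic descent of prime
degree and the quadratic twist (Arthur–Clozel III.4.2, III.3.1), the fibres of quadratic base
change, Tunnell's cuspidal cubic lifts (Theorem [4], JPSS 1981), Chebotarev for Artin
representations, uniqueness and almost-everywhere existence of Satake parameters (Flath
1979), and the bridge (Tunnell p. 173 ¶2) imply `langlands_tunnell_hasEntireContinuation`.
With `strongArtin_of_isDihedralType` at hand the classical dihedral leg is not needed
(`langlands_tunnell_hasEntireContinuation_of_cases`).  Neither Klein's theorem nor lang.S30
nor any weight-one input is a hypothesis. [cite: Tunnell1981, Lemma and Theorem (pp. 174–175)]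
[cite: LanglandsBaseChange1980, §3] [cite: Gelbart1997, §7.1 and §7.2] -/
theorem langlands_tunnell_hasEntireContinuation_of_functoriality
    (hd : strongArtin_of_isDihedralType) (hdesc3 : exists_cuspidal_descent_det_cubic)
    (hGJ : GelbartJacquet_adjoint_lift) (hAd : exists_cuspidal_ad_of_isTetrahedralType)
    (hJS : JacquetShalika_eq_of_rsData_eq) (hdesc : cuspidal_descent_cyclic)
    (htw : exists_twist_quadraticSign) (ha : ArthurClozel_fibres_quadratic)
    (hb : tunnell_cuspidal_cubic_lifts) (hC : chebotarev_artinRep)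
    (hSU : ∀ {n : ℕ} {K : Type} [Field K] [NumberField K]
      {hc : isCompact_glFiniteIntegralLevel n K}
      (π : AutomorphicRepData (AutomorphyDatum.gl n K hc)), π.hasSatakeParamAt_unique)
    (hSC : ∀ {n : ℕ} {K : Type} [Field K] [NumberField K]
      {hc : isCompact_glFiniteIntegralLevel n K}
      (π : AutomorphicRepData (AutomorphyDatum.gl n K hc)), π.hasSatakeParamAt_cofinite)
    (hB : hasEntireContinuation_artinLFunction_of_isPiOfArtinRep) :
    langlands_tunnell_hasEntireContinuation :=
  have ht : strongArtin_of_isTetrahedralType :=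
    strongArtin_of_isTetrahedralType_of_adjoint_lift hd hdesc3 hGJ hAd hJS hC hSU hSC
  langlands_tunnell_hasEntireContinuation_of_cases hd ht
    (strongArtin_of_isOctahedralType_of_tunnell_lemma ht hd hdesc htw
      (tunnell_lemma_of_fibres ha hb hC hSU hSC) hSU hSC) hB

end Literature.NumberTheory.Automorphic

end
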